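import Literature.RepresentationTheory.FiniteGroups.AmalgamCompatibleCharacters
import Literature.RepresentationTheory.FiniteGroups.CompatibleCharactersFiniteQuotient
import Literature.GroupTheory.CombinatorialGroupTheory.FiniteAmalgamTorsionConjugacy
import Literature.GroupTheory.CombinatorialGroupTheory.FiniteAmalgamVirtuallyFree
import Literature.GroupTheory.CombinatorialGroupTheory.VirtuallyFreeConjugacyInfiniteOrder
import Mathlib.GroupTheory.PushoutI
import HarnessLib

/-!
# Amalgamated free products of finite groups are conjugacy separable

Topic `Literature/GroupTheory/CombinatorialGroupTheory`; theorems only (no definition, no named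
fact), over Mathlib's amalgamated product `Monoid.PushoutI φ` of a finite family of FINITE groups
`G i` along injective `φ i : H →* G i`.

**Main theorem** (`Amalgam.isConjugacySeparable_of_finite`): `∗_H G_i` is conjugacy separable
(J. L. Dyer, *Separating conjugates in free-by-finite groups*, J. London Math. Soc. (2) 20 (1979)
215–221, Thm. 1 "free-by-finite groups are c.s.", quoted as Thm. 1 of Dyer, J. Austral. Math. Soc.
A 29 (1980) p. 36, for amalgams of two finite groups; amalgams of finite groups are free-by-finite).
The three cases:

* torsion vs. infinite order — the tree's `Amalgam.exists_normal_finiteIndex_not_isConj_mixed`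
  (order bookkeeping; `FiniteAmalgamTorsionConjugacy`);
* both of infinite order — the tree's
  `VirtuallyFree.exists_normal_finiteIndex_not_isConj_of_not_isOfFinOrder` (Dyer's argument over a
  free normal subgroup of finite index, supplied by `pushoutI_exists_isFreeGroup_normal_finiteIndex`,
  Cohen Ch. 8 Prop. 56);
* **both of finite order — proved HERE by the linear ("trace") method** instead of Dyer's use of the
  Dyer–Scott theorem: torsion elements are conjugate into the factors
  (`Amalgam.exists_conj_eq_of_of_isOfFinOrder`); for factor elements `a ∈ G_i`, `b ∈ G_j` NOT
  related by the equivalence relation generated by conjugacy inside the factors and the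
  identifications `of i (φ_i h) ∼ of j (φ_j h)` (which is all that conjugacy in the amalgam can do to factor
  elements — only the easy direction `related ⇒ conjugate` is needed), the indicator functions of the
  class of `a` form a COMPATIBLE family of class functions separating `a` from `b`; by
  `exists_compatible_characters_apply_ne` (character theory: completeness + rationality of the
  compatibility equations) some compatible family of CHARACTERS separates them, and by
  `exists_hom_finite_group_not_isConj` (realisation on one space + reduction of the finitely
  generated linear group modulo a maximal ideal, traces kept apart) there are homomorphisms
  `G_i → Q` to a FINITE group, agreeing on `H`, hence a homomorphism `∗_H G_i → Q`
  (`PushoutI.lift`), under which `a`, `b` have non-conjugate images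
  (`Amalgam.exists_normal_finiteIndex_not_isConj_of_not_eqvGen`,
  `Amalgam.exists_normal_finiteIndex_not_isConj_torsion`).  The linear method for torsion is that of
  B. Fine, G. Rosenberger, *Conjugacy separability of Fuchsian groups and related questions*,
  Contemp. Math. 109 (1990).

Universe: the character theory of the tree lives in `Type`, so `ι`, the `G i` and `H` are taken in
`Type` (every finite group is isomorphic to one in `Type`).  This file is brick «B6/D1» of the cell's
route to Stebe's theorem on surface groups (F-2732 `SurfaceGroupConjugacySeparable`), nothing of
which is claimed here.

## References

* J. L. Dyer, *Separating conjugates in amalgamated free products and HNN extensions*, J. Austral.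
  Math. Soc. Ser. A 29 (1980) 35–51, Thm. 1, Thm. 2. [Dyer1980]
* W. Magnus, A. Karrass, D. Solitar, *Combinatorial Group Theory* (1966), §4.2 Thm. 4.6.
  [MagnusKarrassSolitar1966]
* D. E. Cohen, *Combinatorial Group Theory: a topological approach* (1989), Ch. 8 Prop. 56.
  [CohenCGT1989]
-/

noncomputable section

namespace Literature.GroupTheory.CombinatorialGroupTheory

open Monoid Monoid.PushoutI
open Literature.RepresentationTheory.FiniteGroups

namespace Amalgam

variable {ι : Type} {G : ι → Type} [∀ i, Group (G i)] {H : Type} [Group H] {φ : ∀ i, H →* G i}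

/-! ### Factor fusion: the easy direction -/

/-- **Related factor elements are conjugate in the amalgam** (the easy half of MKS Thm. 4.6 (i)(ii)
/ Dyer 1980 Thm. 2 (1)(2)): the equivalence relation on `∗_H G_i` generated by `of i a ∼ of i a'` for
`a, a'` conjugate in `G_i` and by `of i (φ_i h) ∼ of j (φ_j h)` is contained in conjugacy.
[cite: MagnusKarrassSolitar1966, §4.2 Thm. 4.6] -/
theorem isConj_of_eqvGen {u v : PushoutI φ}
    (h : Relation.EqvGen (fun u v : PushoutI φ =>
      (∃ (i : ι) (a a' : G i), u = of i a ∧ v = of i a' ∧ IsConj a a') ∨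
      (∃ (h : H) (i j : ι), u = of i (φ i h) ∧ v = of j (φ j h))) u v) :
    IsConj u v := by
  induction h with
  | rel u v huv =>
    rcases huv with ⟨i, a, a', rfl, rfl, hc⟩ | ⟨h, i, j, rfl, rfl⟩
    · exact (of (φ := φ) i).map_isConj hc
    · rw [of_apply_eq_base, of_apply_eq_base]
  | refl u => exact IsConj.refl _
  | symm u v _ ih => exact ih.symm
  | trans u v w _ _ ih₁ ih₂ => exact ih₁.trans ih₂

/-! ### Separation of factor elements in a finite quotient -/

variable [Fintype ι] [DecidableEq ι] [∀ i, Fintype (G i)] [Fintype H]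

/-- **Compatible class functions separate ⇒ a finite quotient separates.**  Let the `G_i`, `H` be
finite, `φ_i` injective, and let `f_i : G_i → ℂ` be class functions with `f_i ∘ φ_i = f_j ∘ φ_j`
and `f_i(a) ≠ f_j(b)`.  Then for some normal subgroup `N` of finite index of `∗_H G_i` the images of
`of i a`, `of j b` in the quotient are NOT conjugate (characters: `exists_compatible_characters_apply_ne`;
finite target: `exists_hom_finite_group_not_isConj`; glue: `PushoutI.lift`).
[cite: Dyer1980, Thm 1 p.36] -/
theorem exists_normal_finiteIndex_not_isConj_of_classFun (hφ : ∀ i, Function.Injective (φ i))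
    (f : ∀ i, G i → ℂ) (hf : ∀ i, IsClassFun (f i)) (hcompat : ∀ i j, f i ∘ φ i = f j ∘ φ j)
    {i j : ι} {a : G i} {b : G j} (hne : f i a ≠ f j b) :
    ∃ (N : Subgroup (PushoutI φ)) (_ : N.Normal) (_ : N.FiniteIndex),
      ¬ IsConj (QuotientGroup.mk (of i a) : PushoutI φ ⧸ N) (QuotientGroup.mk (of j b)) := by
  obtain ⟨ψ, hψ, hψc, hψne⟩ := exists_compatible_characters_apply_ne φ hφ f hf hcompat hne
  obtain ⟨Q, _, _, g, hg, hnc⟩ := exists_hom_finite_group_not_isConj φ ψ hψ hψc hψne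
  -- glue the `g i` to the amalgam
  let F : PushoutI φ →* Q := PushoutI.lift g ((g i).comp (φ i)) fun k => by rw [hg k i]
  have hF : ∀ k (c : G k), F (of k c) = g k c := fun k c => by
    simp only [F, PushoutI.lift_of]
  haveI : Finite F.range := inferInstance
  refine ⟨F.ker, inferInstance, inferInstance, fun hconj => hnc ?_⟩
  have := (QuotientGroup.kerLift F).map_isConj hconj
  rwa [QuotientGroup.kerLift_mk, QuotientGroup.kerLift_mk, hF, hF] at this

/-- **Factor elements not related by factor fusion are separated in a finite quotient.**  If
`of i a`, `of j b` are NOT related by the equivalence relation generated by conjugacy inside the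
factors (`of i a ∼ of i a'`, `a ∼ a'` in `G_i`) and the identifications `of i (φ_i h) ∼ of j (φ_j h)`,
then they have non-conjugate images in some finite quotient of `∗_H G_i` (apply the previous
theorem to the indicator functions of the class of `of i a`, a compatible family of class
functions). [cite: Dyer1980, Thm 1 p.36] -/
theorem exists_normal_finiteIndex_not_isConj_of_not_eqvGen (hφ : ∀ i, Function.Injective (φ i))
    {i j : ι} {a : G i} {b : G j}
    (hab : ¬ Relation.EqvGen (fun u v : PushoutI φ =>
      (∃ (i : ι) (a a' : G i), u = of i a ∧ v = of i a' ∧ IsConj a a') ∨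
      (∃ (h : H) (i j : ι), u = of i (φ i h) ∧ v = of j (φ j h))) (of i a) (of j b)) :
    ∃ (N : Subgroup (PushoutI φ)) (_ : N.Normal) (_ : N.FiniteIndex),
      ¬ IsConj (QuotientGroup.mk (of i a) : PushoutI φ ⧸ N) (QuotientGroup.mk (of j b)) := by
  classical
  -- the fusion relation and the indicator of the class of `of i a`
  set R : PushoutI φ → PushoutI φ → Prop := fun u v =>
      (∃ (i : ι) (a a' : G i), u = of i a ∧ v = of i a' ∧ IsConj a a') ∨
      (∃ (h : H) (i j : ι), u = of i (φ i h) ∧ v = of j (φ j h)) with hR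
  let f : ∀ k, G k → ℂ := fun k c => if Relation.EqvGen R (of k c) (of i a) then 1 else 0
  have hiff : ∀ {u v : PushoutI φ}, Relation.EqvGen R u v →
      (Relation.EqvGen R u (of i a) ↔ Relation.EqvGen R v (of i a)) := fun {u v} huv =>
    ⟨fun hu => Relation.EqvGen.trans _ _ _ (Relation.EqvGen.symm _ _ huv) hu,
      fun hv => Relation.EqvGen.trans _ _ _ huv hv⟩
  have hf : ∀ k, IsClassFun (f k) := by
    intro k s t
    have hrel : Relation.EqvGen R (of k s) (of k (t * s * t⁻¹)) :=
      Relation.EqvGen.rel _ _ (Or.inl ⟨k, s, t * s * t⁻¹, rfl, rfl, isConj_iff.mpr ⟨t, rfl⟩⟩)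
    simp only [f, hiff hrel]
  have hcompat : ∀ k l, f k ∘ φ k = f l ∘ φ l := by
    intro k l
    funext h
    have hrel : Relation.EqvGen R (of k (φ k h)) (of l (φ l h)) :=
      Relation.EqvGen.rel _ _ (Or.inr ⟨h, k, l, rfl, rfl⟩)
    simp only [Function.comp_apply, f, hiff hrel]
  have hne : f i a ≠ f j b := by
    have h1 : f i a = 1 := if_pos (Relation.EqvGen.refl _)
    have h2 : f j b = 0 := if_neg fun h => hab (Relation.EqvGen.symm _ _ h)
    rw [h1, h2]
    exact one_ne_zero
  exact exists_normal_finiteIndex_not_isConj_of_classFun hφ f hf hcompat hne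

/-- **Torsion–torsion pairs in an amalgam of finite groups are conjugacy-separated** (Dyer 1980
Thm. 1, the case left open by the tree's `FiniteAmalgamTorsionConjugacy`; proved by the trace method):
if `x, y ∈ ∗_H G_i` have finite order and are not conjugate, their images in some finite quotient
are not conjugate. [cite: Dyer1980, Thm 1 p.36] -/
theorem exists_normal_finiteIndex_not_isConj_torsion [Nonempty ι]
    (hφ : ∀ i, Function.Injective (φ i)) {x y : PushoutI φ} (hx : IsOfFinOrder x)
    (hy : IsOfFinOrder y) (hxy : ¬ IsConj x y) :
    ∃ (N : Subgroup (PushoutI φ)) (_ : N.Normal) (_ : N.FiniteIndex),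
      ¬ IsConj (QuotientGroup.mk x : PushoutI φ ⧸ N) (QuotientGroup.mk y) := by
  obtain ⟨p, i, a, hp⟩ := exists_conj_eq_of_of_isOfFinOrder hφ hx
  obtain ⟨q, j, b, hq⟩ := exists_conj_eq_of_of_isOfFinOrder hφ hy
  have hxa : IsConj x (of (φ := φ) i a) := isConj_iff.mpr ⟨p, hp⟩
  have hyb : IsConj y (of (φ := φ) j b) := isConj_iff.mpr ⟨q, hq⟩
  have hab : ¬ IsConj (of (φ := φ) i a) (of (φ := φ) j b) := fun h =>
    hxy ((hxa.trans h).trans hyb.symm)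
  have hrel : ¬ Relation.EqvGen (fun u v : PushoutI φ =>
      (∃ (i : ι) (a a' : G i), u = of i a ∧ v = of i a' ∧ IsConj a a') ∨
      (∃ (h : H) (i j : ι), u = of i (φ i h) ∧ v = of j (φ j h))) (of i a) (of j b) := fun h =>
    hab (isConj_of_eqvGen h)
  obtain ⟨N, hN, hNf, hN'⟩ := exists_normal_finiteIndex_not_isConj_of_not_eqvGen hφ hrel
  refine ⟨N, hN, hNf, fun h => hN' ?_⟩
  have hxa' : IsConj (QuotientGroup.mk x : PushoutI φ ⧸ N) (QuotientGroup.mk (of i a)) :=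
    (QuotientGroup.mk' N).map_isConj hxa
  have hyb' : IsConj (QuotientGroup.mk y : PushoutI φ ⧸ N) (QuotientGroup.mk (of j b)) :=
    (QuotientGroup.mk' N).map_isConj hyb
  exact (hxa'.symm.trans h).trans hyb'

/-- All pairs with a TORSION member: if `x ∈ ∗_H G_i` has finite order and `y` is not conjugate to
`x`, their images in some finite quotient are not conjugate (torsion–torsion: the previous theorem;
torsion vs. infinite order: the tree's order bookkeeping `exists_normal_finiteIndex_not_isConj_mixed`).
[cite: Dyer1980, Thm 1 p.36] -/
theorem exists_normal_finiteIndex_not_isConj_of_isOfFinOrder' [Nonempty ι]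
    (hφ : ∀ i, Function.Injective (φ i)) {x y : PushoutI φ} (hx : IsOfFinOrder x)
    (hxy : ¬ IsConj x y) :
    ∃ (N : Subgroup (PushoutI φ)) (_ : N.Normal) (_ : N.FiniteIndex),
      ¬ IsConj (QuotientGroup.mk x : PushoutI φ ⧸ N) (QuotientGroup.mk y) := by
  by_cases hy : IsOfFinOrder y
  · exact exists_normal_finiteIndex_not_isConj_torsion hφ hx hy hxy
  · haveI : ∀ i, Finite (G i) := fun i => inferInstance
    exact exists_normal_finiteIndex_not_isConj_mixed hφ hx hy

/-- **Amalgamated free products of finitely many finite groups are conjugacy separable** (Dyer 1979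
Thm. 1 / Dyer 1980 Thm. 1: free-by-finite groups, in particular amalgams of finite groups, are
c.s.).  Infinite order: Dyer's argument over a free normal subgroup of finite index (the tree's
`VirtuallyFree.exists_normal_finiteIndex_not_isConj_of_not_isOfFinOrder` with
`pushoutI_exists_isFreeGroup_normal_finiteIndex`); finite order: the trace method of this file.
[cite: Dyer1980, Thm 1 p.36] -/
theorem isConjugacySeparable_of_finite [Nonempty ι] (hφ : ∀ i, Function.Injective (φ i)) :
    IsConjugacySeparable (PushoutI φ) := by
  rw [isConjugacySeparable_iff_quotient]
  intro x y hxy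
  by_cases hx : IsOfFinOrder x
  · exact exists_normal_finiteIndex_not_isConj_of_isOfFinOrder' hφ hx hxy
  · haveI : ∀ i, Finite (G i) := fun i => inferInstance
    obtain ⟨K, hK, hKf, hKfree⟩ := pushoutI_exists_isFreeGroup_normal_finiteIndex (φ := φ) hφ
    haveI := hK
    haveI := hKf
    haveI := hKfree
    obtain ⟨N, hN, hNf, h⟩ :=
      VirtuallyFree.exists_normal_finiteIndex_not_isConj_of_not_isOfFinOrder K hx hxy
    exact ⟨N, hN, hNf, h⟩

/-- Epimorphism form: for non-conjugate `x, y` in an amalgam of finitely many finite groups there is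
a homomorphism onto a finite group under which their images are not conjugate.
[cite: Dyer1980, Thm 1 p.36] -/
theorem exists_hom_finite_not_isConj [Nonempty ι] (hφ : ∀ i, Function.Injective (φ i))
    {x y : PushoutI φ} (hxy : ¬ IsConj x y) :
    ∃ (Q : Type) (_ : Group Q) (_ : Finite Q) (ξ : PushoutI φ →* Q),
      Function.Surjective ξ ∧ ¬ IsConj (ξ x) (ξ y) :=
  isConjugacySeparable_of_finite hφ x y hxy

end Amalgam

end Literature.GroupTheory.CombinatorialGroupTheory

end
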